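import Literature.AnabelianGeometry.SemiGraphs.TemperedOrigin
import Literature.AnabelianGeometry.SemiGraphs.TemperedCurveDiscreteRankOneWitness
import HarnessLib

/-!
# [SemiAnbd] §6 over the ORIGIN certificate, II: the universal closures of
# `TemperedOrigin.ProfiniteNormalizersHolds` / `DenseSubgroupsHolds` / `ProfiniteOuterIsoLiftsHolds`
# are FALSE (FACT-LIST rows F-1706, F-1705, F-1707)

Mochizuki, *Semi-graphs of anabelioids*, Publ. RIMS **42** (2006) [SemiAnbd], §6: Lemma 6.1 (ii)(iii)
p. 69, Lemma 6.3 (ii)(iii) p. 70, Theorem 6.6 p. 72. [cite: MochizukiSemiAnbd2006, §6 pp.69-72]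

PROOF-ONLY companion (abc-iut cell, block F; no `def`, nothing restated) of `TemperedOrigin.lean`
(abc-iut-L3: the printed §6 statements bundled over an uninterpreted ORIGIN certificate
`Ω : TemperedOrigin p`, "asserted only for certified `X`") completing abc-iut-f-056's
`TemperedOriginSchemaNegative.lean` (rows F-1704 / F-1708 refuted there; for F-1705 / F-1706 / F-1707 that
file records consistency instances only and its author posted «NEEDS … no ∀Ω refutation (needs
non-trivial junk completion)»).  The needed junk completion IS in the tree: abc-iut-w6-d028's
`TemperedCurveDiscreteRankOneWitness.lean` inhabits the interface `TemperedCurve p` by the RANK-ONE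
ABELIAN datum `Π^temp := ℤ × G_{ℚ_p} ↪ Π := Ẑ × G_{ℚ_p}` (`ℤ` discrete; a genuine, injective,
NON-surjective profinite completion) and proves that [SemiAnbd] Lem. 6.1 (iii)
(`PiTempNormallyTerminal`), Lem. 6.3 (iii) (`PiTempDenseDOFConjugator`) and Thm. 6.6
(`ProfiniteOuterIsoLifts`) FAIL there (`not_forall_piTempNormallyTerminal`,
`not_forall_piTempDenseDOFConjugator`, `not_forall_profiniteOuterIsoLifts`).  Since the certificate `Ω`
is a FREE predicate, the constant-`True` certificate certifies that datum, so:

* `TemperedCurve.not_forall_profiniteNormalizersHolds` (F-1706), `…denseSubgroupsHolds` (F-1705),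
  `…profiniteOuterIsoLiftsHolds` (F-1707): for EVERY prime `p`, `¬ ∀ Ω : TemperedOrigin p, Ω.…Holds`;
* `TemperedCurve.not_forall_prime_…Holds`: the literal universal closures (over `p` and `Ω`) are false.

HONEST FRAMING: a junk inhabitant + the vacuous certificate refute the universal closure of OUR schema,
not the printed theorems (which concern André's `π₁^temp` of hyperbolic curves, `Δ^temp` free of rank
`> 1`); the rows remain consumable only at a certified origin (the L3 reductions
`TemperedOrigin.profiniteNormalizersHolds_of_tower` / `_of_isTempered`, `denseSubgroupsHolds_of_tower`,
`profiniteOuterIsoLiftsHolds_of_tower` name exactly what that takes).  Nothing of [SemiAnbd] is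
asserted; no side is taken on [IUTchIII] Cor. 3.12; typed ≠ proved.
-/

namespace Literature.AnabelianGeometry.SemiGraphs.TemperedCurve

/-! ### Per prime: the constant-`True` certificate meets w6-d028's rank-one datum -/

/-- **F-1706, ∀Ω-closure REFUTED** ([SemiAnbd] Lem. 6.1 (ii)(iii) bundled over the origin certificate):
for every prime `p` it is false that `Ω.ProfiniteNormalizersHolds` for all `Ω : TemperedOrigin p` — at
`Ω := ⟨fun _ => True⟩` the (iii)-conjunct `PiTempNormallyTerminal` fails at the rank-one datum
`ℤ × G_{ℚ_p} ↪ Ẑ × G_{ℚ_p}` (`not_forall_piTempNormallyTerminal`).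
[cite: MochizukiSemiAnbd2006, Lem 6.1(ii)-(iii) p.69] -/
theorem not_forall_profiniteNormalizersHolds (p : ℕ) [Fact p.Prime] :
    ¬ ∀ Ω : TemperedOrigin p, Ω.ProfiniteNormalizersHolds := fun h =>
  not_forall_piTempNormallyTerminal p fun X => (h ⟨fun _ => True⟩ X trivial).2

/-- **F-1705, ∀Ω-closure REFUTED** ([SemiAnbd] Lem. 6.3 (ii)(iii) bundled over the origin certificate):
for every prime `p` it is false that `Ω.DenseSubgroupsHolds` for all `Ω : TemperedOrigin p` — at
`Ω := ⟨fun _ => True⟩` the conjunct `PiTempDenseDOFConjugator` (Lem. 6.3 (iii), `F = Π^temp`) fails at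
the rank-one datum (`not_forall_piTempDenseDOFConjugator`).
[cite: MochizukiSemiAnbd2006, Lem 6.3(ii)-(iii) p.70] -/
theorem not_forall_denseSubgroupsHolds (p : ℕ) [Fact p.Prime] :
    ¬ ∀ Ω : TemperedOrigin p, Ω.DenseSubgroupsHolds := fun h =>
  not_forall_piTempDenseDOFConjugator p fun X => (h ⟨fun _ => True⟩ X trivial).2.2.1

/-- **F-1707, ∀Ω-closure REFUTED** ([SemiAnbd] Thm. 6.6 bundled over the origin certificate): for every
prime `p` it is false that `Ω.ProfiniteOuterIsoLiftsHolds` for all `Ω : TemperedOrigin p` — at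
`Ω := ⟨fun _ => True⟩`, Thm. 6.6 as typed fails for the pair (profinite twin `Ẑ × G_{ℚ_p}`, rank-one
datum): the identity of `Π` has no tempered lift `Ẑ × G_{ℚ_p} ≃ₜ* ℤ × G_{ℚ_p}`
(`not_forall_profiniteOuterIsoLifts`). [cite: MochizukiSemiAnbd2006, Thm 6.6 p.72] -/
theorem not_forall_profiniteOuterIsoLiftsHolds (p : ℕ) [Fact p.Prime] :
    ¬ ∀ Ω : TemperedOrigin p, Ω.ProfiniteOuterIsoLiftsHolds := fun h =>
  not_forall_profiniteOuterIsoLifts p fun X Y => h ⟨fun _ => True⟩ X Y trivial trivial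

/-! ### The literal universal closures (over the prime and the certificate) -/

/-- The universal closure of `TemperedOrigin.ProfiniteNormalizersHolds` over ALL its binders (the prime
`p` and the certificate `Ω`) is false (instance: `p = 2`). [cite: MochizukiSemiAnbd2006, Lem 6.1(ii)-(iii) p.69] -/
theorem not_forall_prime_profiniteNormalizersHolds :
    ¬ ∀ (p : ℕ) [Fact p.Prime] (Ω : TemperedOrigin p),
        Literature.AnabelianGeometry.SemiGraphs.TemperedOrigin.ProfiniteNormalizersHolds Ω := fun h =>
  haveI : Fact (Nat.Prime 2) := ⟨Nat.prime_two⟩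
  not_forall_profiniteNormalizersHolds 2 (h 2)

/-- The universal closure of `TemperedOrigin.DenseSubgroupsHolds` over all its binders is false
(instance: `p = 2`). [cite: MochizukiSemiAnbd2006, Lem 6.3(ii)-(iii) p.70] -/
theorem not_forall_prime_denseSubgroupsHolds :
    ¬ ∀ (p : ℕ) [Fact p.Prime] (Ω : TemperedOrigin p),
        Literature.AnabelianGeometry.SemiGraphs.TemperedOrigin.DenseSubgroupsHolds Ω := fun h =>
  haveI : Fact (Nat.Prime 2) := ⟨Nat.prime_two⟩
  not_forall_denseSubgroupsHolds 2 (h 2)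

/-- The universal closure of `TemperedOrigin.ProfiniteOuterIsoLiftsHolds` over all its binders is false
(instance: `p = 2`). [cite: MochizukiSemiAnbd2006, Thm 6.6 p.72] -/
theorem not_forall_prime_profiniteOuterIsoLiftsHolds :
    ¬ ∀ (p : ℕ) [Fact p.Prime] (Ω : TemperedOrigin p),
        Literature.AnabelianGeometry.SemiGraphs.TemperedOrigin.ProfiniteOuterIsoLiftsHolds Ω := fun h =>
  haveI : Fact (Nat.Prime 2) := ⟨Nat.prime_two⟩
  not_forall_profiniteOuterIsoLiftsHolds 2 (h 2)

end Literature.AnabelianGeometry.SemiGraphs.TemperedCurve
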